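import Literature.AnabelianGeometry.SemiGraphs.Temperoids
import Literature.AnabelianGeometry.SemiGraphs.TemperedPiChartExists
import Literature.AnabelianGeometry.SemiGraphs.TemperedPiChartConnectedTemperoid
import HarnessLib

/-!
# [SemiAnbd] Def 3.1 (ii): every connected temperoid is a temperoid — NON-VACUITY of the interface
# `TemperoidChart` / `IsTemperoid` (abc-iut L3 inhabitation census v1, row `TemperoidChart`: zero producers)

Mochizuki, *Semi-graphs of anabelioids*, Publ. RIMS **42** (2006), §3, Definition 3.1 (ii), p. 33
(PRIMS p. 253): "Any category equivalent to a category of the form `B^temp(Π)` … will be referred to as a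
*connected temperoid*. Any category equivalent to a product [in the sense of a product of categories] of a
countable [hence possibly empty!] collection of connected temperoids will be referred to as a *temperoid*."
[cite: MochizukiSemiAnbd2006, Def 3.1(ii) p.33]

PROOF-ONLY file (abc-iut cell, wave-4 prover abc-iut-w4-d098; no `def`/`instance`/`structure` declared —
every chart is built inside a theorem term).  The typer's `IsTemperoid T := Nonempty (TemperoidChart T)`
(abc-iut-L3-t2, `Temperoids.lean`) had NO producer in the tree (INHABITATION-CENSUS-L3-v1 §A1), although
`IsConnectedTemperoid` has several: the missing link is the tautology printed in Def 3.1 (ii) that a connected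
temperoid is a temperoid (the product over a ONE-element index set).  We supply it:

* `IsConnectedTemperoid.isTemperoid` — `T ≌ B^temp(Π)` ⇒ `T ≌ ∏_{i ∈ {*}} B^temp(Π)` (the equivalence
  `C ≌ (PUnit → C)` built from Mathlib's `Functor.pi'` / `Pi.eval`);
* `isTemperoid_bTemp` — `B^temp(Π)` is a temperoid for every tempered `Π` (GENUINE model);
* `ProfiniteSemiGraph.isTemperoid_bTempCat` — `B^temp(𝒢)` is a temperoid for every semi-graph of anabelioids
  satisfying the hypotheses of Prop 3.6 (through abc-iut-L3-t9's chart `temperedPiChart`, p416764) — the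
  "In particular, … is a connected temperoid" clause of Prop 3.6 (ii) p. 38 in the `IsTemperoid` currency.

Plain category theory; nothing here bears on [IUTchIII] Cor. 3.12.
-/

namespace Literature.AnabelianGeometry.SemiGraphs

open CategoryTheory

universe v₁ u u₁

/-- **Def 3.1 (ii): a connected temperoid is a temperoid** (product over the one-point index set).
[cite: MochizukiSemiAnbd2006, Def 3.1(ii) p.33] -/
theorem IsConnectedTemperoid.isTemperoid {T : Type u₁} [Category.{v₁} T]
    (h : IsConnectedTemperoid.{v₁, u, u₁} T) : IsTemperoid.{v₁, u, u₁} T := by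
  obtain ⟨c⟩ := h
  -- the equivalence `B^temp(Π) ≌ ∏_{i : PUnit} B^temp(Π)`
  let e : BTemp c.G ≌ (∀ _ : PUnit.{1}, BTemp c.G) :=
    CategoryTheory.Equivalence.mk (Functor.pi' fun _ => 𝟭 (BTemp c.G)) (Pi.eval _ PUnit.unit)
      (Functor.pi'CompEval (fun _ => 𝟭 (BTemp c.G)) PUnit.unit).symm
      (NatIso.ofComponents (fun X => Pi.isoMk fun _ => Iso.refl _) (by
        intro X Y f
        ext i
        rfl))
  exact ⟨{ ι := PUnit.{1}
           countable := inferInstance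
           G := fun _ => c.G
           isTempered := fun _ => c.isTempered
           equiv := c.equiv.trans e }⟩

/-- **`B^temp(Π)` is a temperoid** for every tempered topological group `Π` (GENUINE model of the interface
`TemperoidChart`; Def 3.1 (ii) p. 33). [cite: MochizukiSemiAnbd2006, Def 3.1(ii) p.33] -/
theorem isTemperoid_bTemp (G : Type u) [Group G] [TopologicalSpace G] [IsTopologicalGroup G]
    (hG : IsTempered G) : IsTemperoid.{u, u, u + 1} (BTemp G) :=
  IsConnectedTemperoid.isTemperoid ⟨{ G := G, isTempered := hG, equiv := CategoryTheory.Equivalence.refl }⟩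

/-- The interface `TemperoidChart` is inhabited at `B^temp(Π)` (non-vacuity witness, genuine).
[cite: MochizukiSemiAnbd2006, Def 3.1(ii) p.33] -/
theorem TemperoidChart.nonempty_model (G : Type u) [Group G] [TopologicalSpace G] [IsTopologicalGroup G]
    (hG : IsTempered G) : Nonempty (TemperoidChart.{u, u, u + 1} (BTemp G)) :=
  isTemperoid_bTemp G hG

/-- **[SemiAnbd] Prop 3.6 (ii) "In particular"**, in the `IsTemperoid` currency: for a semi-graph of
anabelioids satisfying the hypotheses of Prop 3.6, `B^temp(𝒢)` is a temperoid (via abc-iut-L3-t9's chart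
`temperedPiChart`, p416764, and `IsConnectedTemperoid.isTemperoid`). [cite: MochizukiSemiAnbd2006, Prop 3.6(ii) p.38] -/
theorem ProfiniteSemiGraph.isTemperoid_bTempCat (𝒢 : ProfiniteSemiGraph.{u}) (h36 : 𝒢.Prop36Hypotheses) :
    IsTemperoid.{u, u, u + 1} 𝒢.BTempCat :=
  IsConnectedTemperoid.isTemperoid (𝒢.temperedPiChart h36).isConnectedTemperoid

end Literature.AnabelianGeometry.SemiGraphs
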